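import Literature.NumberTheory.LFunctions.Zhang2022.RepairDiscSFiberCert
import Literature.NumberTheory.LFunctions.Zhang2022.RepairCrossFormSection10H2
import Literature.NumberTheory.LFunctions.Zhang2022.RepairSection10Theta
import Literature.NumberTheory.LFunctions.Zhang2022.Section18EpsilonIdentity
import Literature.NumberTheory.LFunctions.Zhang2022.Section10Certificate

/-!
# Zhang (2022) design-space objective, twin part 2: the certified data-row format and its kernel checker

Y. Zhang, *Discrete mean estimates and the Landau–Siegel zero*, arXiv:2211.02515v1 (2022)
[Zhang2022LandauSiegel] — an unrefereed manuscript under adjudication. **This file SEARCHES and TYPES; it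
makes no claim about Landau–Siegel zeros, about Theorems 1–2 of the manuscript, or about a repaired
(2.32), until a kernel theorem says so.** Companion of `ObjectiveTwin` (LANDAU–SIEGEL programme, charter
LS-PROGRAMME v1.1 §2 row A, deliverable 2 of the Lean-twin seat): the FORMAT in which the two certified
numerics lineages report a design's three endgame constants, and the `decide`-able CHECKS that turn such a
row into a kernel proof of `C₂₃₂·C₂₃₃ < |𝔡′+𝔡|²` («the design closes», `ObjectiveTwin.MainTerms.Closes`
via `MainTerms.closes_iff`) or of its negation. Stated over the raw numbers `(C₂₃₂, C₂₃₃, 𝔡′+𝔡)` so that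
it depends on nothing but the tree's certificates.

## Format (schema v1)

One row per design: eight rationals `c232lo c232hi c233lo c233hi relo rehi imlo imhi` = a closed box for
`(C₂₃₂, C₂₃₃, Re(𝔡′+𝔡), Im(𝔡′+𝔡))` with outward-rounded endpoints (`TermsBox`), plus — outside the
kernel — the design coordinates, the lineage, the kit job id and the code/input sha16. The ENCLOSURE
`TermsBox.Mem b C232 C233 cross` is the statement a lineage certifies; for a design outside class `R` it is
an `E(d)`-level claim about NAMED main-term functionals (typed by the family's typers), for the printed
design `θ₀` it is a theorem of the tree (`theta0Box_mem`).

## Checks and soundness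

* `TermsBox.closesCheck` (`0 ≤ c232lo`, `0 ≤ c233lo`, `c232hi·c233hi < absLower(re)² + absLower(im)²`) and
  `closes_of_closesCheck : closesCheck = true → Mem → C₂₃₂·C₂₃₃ < |𝔡′+𝔡|²`;
* `TermsBox.barrierCheck` (`absUpper(re)² + absUpper(im)² ≤ c232lo·c233lo`) and
  `not_closes_of_barrierCheck : barrierCheck = true → Mem → ¬ (C₂₃₂·C₂₃₃ < |𝔡′+𝔡|²)`.

## CONTROL rows

* `theta0Box` / `theta0Box_mem` / `theta0Box_barrierCheck` / `controlBox_theta0`: the printed design's row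
  from the kernel brackets (`C232S_theta0_bounds`, `C233_bounds`, `dsum_re_bounds`, `dprime/dfrak_im_bounds`),
  the check evaluated by `decide`/`norm_num`, and `¬ (C232S θ₀ · C233T θ₀ < |dSumS θ₀|²)` re-derived from the
  row alone (agrees with `Repair.not_repairable_true_need _ admissible_theta0`);
* `controlSec18_readings`: every documented READING of the printed §18 total `𝔠₁ + 𝔠₂ + 2Re 𝔠₃` (second
  constant `𝔠₂` or `𝔠₂ᶜ`, third constant `𝔠₃ʳ`, `𝔠₃`, `𝔠₃ᴰ`) lies in `(0.0551, 0.0632)` — the charter's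
  «§18 total ∈ [0.0552, 0.0632]» as a kernel hull of the tree brackets (certified values `0.0631676`,
  `0.0553459`, `0.0630223`, `0.0631567`, `0.0553350`, `0.0552007`).

Pure definitions and linear arithmetic; no analytic content, no new `Prop` facts about the manuscript.
-/

noncomputable section

open Real Complex ComplexConjugate Set

namespace Literature.NumberTheory.LFunctions.Zhang2022

namespace Objective

open Repair

/-! ## The data row and the enclosure statement -/

/-- **The data row of a design** as emitted by a certified-numerics lineage: a closed rational box for
`(C₂₃₂, C₂₃₃, Re(𝔡′+𝔡), Im(𝔡′+𝔡))` — eight rationals (outward-rounded interval endpoints).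
[cite: Zhang2022LandauSiegel, §2 (2.18), (2.32)–(2.33)] -/
structure TermsBox where
  /-- lower endpoint for `C₂₃₂` -/
  c232lo : ℚ
  /-- upper endpoint for `C₂₃₂` -/
  c232hi : ℚ
  /-- lower endpoint for `C₂₃₃` -/
  c233lo : ℚ
  /-- upper endpoint for `C₂₃₃` -/
  c233hi : ℚ
  /-- lower endpoint for `Re(𝔡′+𝔡)` -/
  relo : ℚ
  /-- upper endpoint for `Re(𝔡′+𝔡)` -/
  rehi : ℚ
  /-- lower endpoint for `Im(𝔡′+𝔡)` -/
  imlo : ℚ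
  /-- upper endpoint for `Im(𝔡′+𝔡)` -/
  imhi : ℚ

namespace TermsBox

/-- The ENCLOSURE statement: the design's true constants `(C₂₃₂, C₂₃₃, 𝔡′+𝔡)` lie in the box.
[cite: Zhang2022LandauSiegel, §2 (2.18), (2.32)–(2.33)] -/
def Mem (b : TermsBox) (C232 C233 : ℝ) (cross : ℂ) : Prop :=
  ((b.c232lo : ℝ) ≤ C232 ∧ C232 ≤ b.c232hi) ∧ ((b.c233lo : ℝ) ≤ C233 ∧ C233 ≤ b.c233hi) ∧
    ((b.relo : ℝ) ≤ cross.re ∧ cross.re ≤ b.rehi) ∧ ((b.imlo : ℝ) ≤ cross.im ∧ cross.im ≤ b.imhi)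

/-- A rational lower bound for `|t|` on `[lo, hi]`: `max(lo, −hi, 0)`. [folklore] -/
def absLower (lo hi : ℚ) : ℚ := max (max lo (-hi)) 0

/-- A rational upper bound for `|t|` on `[lo, hi]`: `max(−lo, hi)`. [folklore] -/
def absUpper (lo hi : ℚ) : ℚ := max (-lo) hi

/-- `absLower lo hi ≤ |t|` for `t ∈ [lo, hi]`. [folklore] -/
private theorem absLower_le_abs {lo hi : ℚ} {t : ℝ} (h1 : (lo : ℝ) ≤ t) (h2 : t ≤ hi) :
    ((absLower lo hi : ℚ) : ℝ) ≤ |t| := by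
  unfold absLower; push_cast
  exact max_le (max_le (h1.trans (le_abs_self t)) (by linarith [neg_abs_le t])) (abs_nonneg t)

/-- `|t| ≤ absUpper lo hi` for `t ∈ [lo, hi]`. [folklore] -/
private theorem abs_le_absUpper {lo hi : ℚ} {t : ℝ} (h1 : (lo : ℝ) ≤ t) (h2 : t ≤ hi) :
    |t| ≤ ((absUpper lo hi : ℚ) : ℝ) := by
  unfold absUpper; push_cast
  exact abs_le.2 ⟨by linarith [le_max_left (-(lo:ℝ)) hi], h2.trans (le_max_right _ _)⟩

/-- `absLower² ≤ t²` on `[lo, hi]`. [folklore] -/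
private theorem absLower_sq_le {lo hi : ℚ} {t : ℝ} (h1 : (lo : ℝ) ≤ t) (h2 : t ≤ hi) :
    ((absLower lo hi : ℚ) : ℝ) ^ 2 ≤ t ^ 2 := by
  have h0 : (0 : ℝ) ≤ ((absLower lo hi : ℚ) : ℝ) := by unfold absLower; push_cast; exact le_max_right _ _
  rw [← sq_abs t]
  exact pow_le_pow_left₀ h0 (absLower_le_abs h1 h2) 2

/-- `t² ≤ absUpper²` on `[lo, hi]`. [folklore] -/
private theorem sq_le_absUpper {lo hi : ℚ} {t : ℝ} (h1 : (lo : ℝ) ≤ t) (h2 : t ≤ hi) :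
    t ^ 2 ≤ ((absUpper lo hi : ℚ) : ℝ) ^ 2 := by
  rw [← sq_abs t]
  exact pow_le_pow_left₀ (abs_nonneg t) (abs_le_absUpper h1 h2) 2

/-! ## The two checks and their soundness -/

/-- **CLOSES check** (decidable on the rationals): with `0 ≤ c232lo`, `0 ≤ c233lo`, every point of the box
closes as soon as `c232hi·c233hi < absLower(re)² + absLower(im)²`. [cite: Zhang2022LandauSiegel, §2 (2.18), Props. 2.4–2.6] -/
def closesCheck (b : TermsBox) : Bool :=
  decide (0 ≤ b.c232lo) && decide (0 ≤ b.c233lo) &&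
    decide (b.c232hi * b.c233hi < absLower b.relo b.rehi ^ 2 + absLower b.imlo b.imhi ^ 2)

/-- **BARRIER check** (decidable on the rationals): with `0 ≤ c232lo`, `0 ≤ c233lo`, no point of the box
closes as soon as `absUpper(re)² + absUpper(im)² ≤ c232lo·c233lo`. [cite: Zhang2022LandauSiegel, §2 (2.18), Props. 2.4–2.6] -/
def barrierCheck (b : TermsBox) : Bool :=
  decide (0 ≤ b.c232lo) && decide (0 ≤ b.c233lo) &&
    decide (absUpper b.relo b.rehi ^ 2 + absUpper b.imlo b.imhi ^ 2 ≤ b.c232lo * b.c233lo)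

variable {b : TermsBox} {C232 C233 : ℝ} {cross : ℂ}

/-- `‖z‖² = Re² + Im²`. [folklore] -/
private theorem norm_sq_eq_re_sq_add_im_sq (z : ℂ) : ‖z‖ ^ 2 = z.re ^ 2 + z.im ^ 2 := by
  rw [Complex.sq_norm, Complex.normSq_apply]; ring

/-- **Checker soundness (door side)**: a passed `closesCheck` and a certified enclosure give
`C₂₃₂·C₂₃₃ < |𝔡′+𝔡|²` — the kernel re-proof of a candidate's `OBJ(d) < 0` from its data row.
[cite: Zhang2022LandauSiegel, §2 (2.18), Props. 2.4–2.6] -/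
theorem closes_of_closesCheck (hb : b.closesCheck = true) (hm : b.Mem C232 C233 cross) :
    C232 * C233 < ‖cross‖ ^ 2 := by
  simp only [closesCheck, Bool.and_eq_true, decide_eq_true_eq] at hb
  obtain ⟨⟨h0, h0'⟩, hlt⟩ := hb
  obtain ⟨⟨h1, h2⟩, ⟨h3, h4⟩, ⟨h5, h6⟩, ⟨h7, h8⟩⟩ := hm
  have hlt' : ((b.c232hi : ℚ) : ℝ) * b.c233hi <
      ((absLower b.relo b.rehi : ℚ) : ℝ) ^ 2 + ((absLower b.imlo b.imhi : ℚ) : ℝ) ^ 2 := by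
    exact_mod_cast hlt
  have h0r : (0 : ℝ) ≤ b.c232lo := by exact_mod_cast h0
  have h0r' : (0 : ℝ) ≤ b.c233lo := by exact_mod_cast h0'
  have hre := absLower_sq_le h5 h6
  have him := absLower_sq_le h7 h8
  rw [norm_sq_eq_re_sq_add_im_sq]
  have hprod : C232 * C233 ≤ (b.c232hi : ℝ) * b.c233hi :=
    mul_le_mul h2 h4 (h0r'.trans h3) (h0r.trans (h1.trans h2))
  linarith

/-- **Checker soundness (barrier side)**: a passed `barrierCheck` and a certified enclosure give
`¬ (C₂₃₂·C₂₃₃ < |𝔡′+𝔡|²)`. [cite: Zhang2022LandauSiegel, §2 (2.18), Props. 2.4–2.6] -/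
theorem not_closes_of_barrierCheck (hb : b.barrierCheck = true) (hm : b.Mem C232 C233 cross) :
    ¬ (C232 * C233 < ‖cross‖ ^ 2) := by
  simp only [barrierCheck, Bool.and_eq_true, decide_eq_true_eq] at hb
  obtain ⟨⟨h0, h0'⟩, hle⟩ := hb
  obtain ⟨⟨h1, h2⟩, ⟨h3, h4⟩, ⟨h5, h6⟩, ⟨h7, h8⟩⟩ := hm
  have hle' : ((absUpper b.relo b.rehi : ℚ) : ℝ) ^ 2 + ((absUpper b.imlo b.imhi : ℚ) : ℝ) ^ 2 ≤
      ((b.c232lo : ℚ) : ℝ) * b.c233lo := by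
    exact_mod_cast hle
  have h0r : (0 : ℝ) ≤ b.c232lo := by exact_mod_cast h0
  have h0r' : (0 : ℝ) ≤ b.c233lo := by exact_mod_cast h0'
  have hre := sq_le_absUpper h5 h6
  have him := sq_le_absUpper h7 h8
  rw [norm_sq_eq_re_sq_add_im_sq, not_lt]
  have hprod : (b.c232lo : ℝ) * b.c233lo ≤ C232 * C233 := mul_le_mul h1 h3 h0r' (h0r.trans h1)
  linarith

end TermsBox

/-! ## CONTROL rows -/

/-- **The data row of the printed design `θ₀`** (from the tree brackets `C232S_theta0_bounds`, `C233_bounds`,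
`dsum_re_bounds`, `dprime_im_bounds` + `dfrak_im_bounds`): `C₂₃₂ ∈ [0.055341, 0.055342]`,
`C₂₃₃ ∈ [2546.8476, 2546.8478]`, `Re(𝔡′+𝔡) ∈ [5.15886, 5.15887]`, `Im(𝔡′+𝔡) ∈ [1.210488, 1.210492]`.
[cite: Zhang2022LandauSiegel, §2 (2.32)–(2.33); §10 (10.17); §18 p.99] -/
def theta0Box : TermsBox where
  c232lo := 0.055341
  c232hi := 0.055342
  c233lo := 2546.8476
  c233hi := 2546.8478
  relo := 5.15886
  rehi := 5.15887
  imlo := 1.210488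
  imhi := 1.210492

/-- The constants of record at `θ₀` — `C232S θ₀`, `C233T θ₀ = C233`, `dSumS θ₀ = 𝔡′ + 𝔡` — lie in
`theta0Box` (kernel brackets). [cite: Zhang2022LandauSiegel, §2 (2.32)–(2.33); §10 (10.17); §18 p.99] -/
theorem theta0Box_mem : theta0Box.Mem (C232S theta0) (C233T theta0) (dSumS theta0) := by
  have h1 := C232S_theta0_bounds
  have h2 := C233_bounds
  have h3 := dsum_re_bounds
  have h4 := dprime_im_bounds
  have h5 := dfrak_im_bounds
  unfold TermsBox.Mem theta0Box
  rw [C233T_theta0, dSumS_theta0]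
  push_cast
  refine ⟨⟨h1.1.le, h1.2.le⟩, ⟨h2.1.le, h2.2.le⟩, ⟨h3.1.le, h3.2.le⟩, ?_⟩
  rw [Complex.add_im]
  constructor <;> linarith [h4.1, h4.2, h5.1, h5.2]

/-- `theta0Box` passes the barrier check (`0.055341 × 2546.8476 = 140.94… ≥ 28.0793 ≥ |𝔡′+𝔡|²`).
[cite: Zhang2022LandauSiegel, §2 (2.32)–(2.33); §10 (10.17)] -/
theorem theta0Box_barrierCheck : theta0Box.barrierCheck = true := by
  simp only [TermsBox.barrierCheck, TermsBox.absUpper, theta0Box, Bool.and_eq_true, decide_eq_true_eq]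
  norm_num

/-- **CONTROL for the checker pipeline**: the printed design does not close, re-derived from its data row
alone — `¬ (C232S θ₀ · C233T θ₀ < |dSumS θ₀|²)` (the instance `θ₀` of `Repair.not_repairable_true_need`).
[cite: Zhang2022LandauSiegel, §2 (2.32)–(2.33); §10 (10.17)] -/
theorem controlBox_theta0 : ¬ (C232S theta0 * C233T theta0 < ‖dSumS theta0‖ ^ 2) :=
  TermsBox.not_closes_of_barrierCheck theta0Box_barrierCheck theta0Box_mem

/-- **C1 (all documented readings of the printed §18 total)**: with the printed (`𝔠₂`, prefactor `0.504`)
or corrected (`𝔠₂ᶜ`, prefactor `0.5`) second constant and the reduced / stated / derived third constant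
(`𝔠₃ʳ`, `𝔠₃`, `𝔠₃ᴰ`), every reading of `𝔠₁ + 𝔠₂ + 2Re 𝔠₃` lies in `(0.0551, 0.0632)` (tree brackets
`frakc1_re_bounds`, `frakc2(c)_re_bounds`, `frakc3(r,D)_re_bounds`). [cite: Zhang2022LandauSiegel, §18 p.99] -/
theorem controlSec18_readings :
    (frakc1.re + frakc2.re + 2 * frakc3r.re ∈ Ioo (0.0551 : ℝ) 0.0632)
    ∧ (frakc1.re + frakc2c.re + 2 * frakc3r.re ∈ Ioo (0.0551 : ℝ) 0.0632)
    ∧ (frakc1.re + frakc2.re + 2 * frakc3.re ∈ Ioo (0.0551 : ℝ) 0.0632)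
    ∧ (frakc1.re + frakc2.re + 2 * frakc3D.re ∈ Ioo (0.0551 : ℝ) 0.0632)
    ∧ (frakc1.re + frakc2c.re + 2 * frakc3D.re ∈ Ioo (0.0551 : ℝ) 0.0632)
    ∧ (frakc1.re + frakc2c.re + 2 * frakc3.re ∈ Ioo (0.0551 : ℝ) 0.0632) := by
  have h1 := frakc1_re_bounds
  have h2 := frakc2_re_bounds
  have h2c := frakc2c_re_bounds
  have h3 := frakc3r_re_bounds
  have h3p := frakc3_re_bounds
  have h3D := frakc3D_re_bounds
  simp only [mem_Ioo]
  refine ⟨⟨?_, ?_⟩, ⟨?_, ?_⟩, ⟨?_, ?_⟩, ⟨?_, ?_⟩, ⟨?_, ?_⟩, ⟨?_, ?_⟩⟩ <;> linarith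

end Objective

end Literature.NumberTheory.LFunctions.Zhang2022
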